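import Literature.MathematicalPhysics.QuantumFieldTheory.Balaban1983to89.B13ChainJointNonvacuityOddL
import Literature.MathematicalPhysics.QuantumFieldTheory.Balaban1983to89.B13VolumeDialNumerals

/-!
# `Balaban1983to89.B13ChainJointNonvacuityPrefactorsVol` — T. Bałaban, *Renormalization group approach to lattice gauge field theories. II.
Cluster expansions*, Commun. Math. Phys. **116** (1988) 1–22, doi:10.1007/bf01239022 [Balaban1988RG2Cluster]:
**JOINT NON-VACUITY OF THE N10 JUNCTION's NUMERICS AT THE RECORD's ODD BLOCK SIZE, VOLUME BINDER LOCATED — every real letter the reduced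
junction `b13LeafOfRecord_bondTower_of_numerics` asks for, chosen at once, for every block size `L ≥ 8` and every bond fineness `m₃ + 1`**

statement-level skeleton of published theorems with citation tags; proofs where landed; nothing here is a claim about the
Yang–Mills mass gap

CITATION HEADER (verbatim).  p. 21 [PDF 21], closing paragraph: *"The assumptions allow finally us to fix all the constants, or rather bounds on these
constants.  … Next we fix M in such a way that the restrictions on α₀(B₀M⁻¹)^{1/2}, or γ₁, are satisfied … we choose α₁, which determines γ₂ …
Finally we fix α₀ = α₁(B₀M⁻¹)^{-1/2}"*; p. 17, (2.24)–(2.26); p. 16, (2.16)–(2.18), after (2.22) «γ₂ is a small, positive constant»; p. 20, Lemma 3.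
NOT PRINTED: every explicit number below — witness data for TYPED hypothesis lists, not Bałaban's constants.

WHY THIS FILE (cell `pub-ymgap`, node N10 = [B13], seat `pub-ymgap-dag-n10-w3` g4; item (b2) of the seat's located odd-L numerics, after
`B13ChainJointNonvacuityOddL` (b1)).  `Summits/…/BalabanUVNodesN10B13BondTowerReduced.b13LeafOfRecord_bondTower_of_numerics` (p621116) reduced the
junction of record (67V ∕ 67VL) at the bond tower to ≈ 45 hypotheses over REAL letters: the constants' thresholds, Lemma 3's numerics AT THE RECORD's
ODD BLOCK SIZE `θ.ℓ₆ + 1` and bond fineness `m₃ + 1`, (2.18), R12, one `cp`, the rung at one admissible reference package with the tower's margins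
(`m₀ ≤ 4`, `1 ≤ n_B`, `1 ≤ d_m`), NODE A's budget and floor at `ν = m_F = 1`, `c₀ = r_C = 0`, `BΔ ≥ 4`, the (2.24)–(2.26) located numerals at `m = ν = 1`,
`m′ = 4(m₃+1)⁴`, p. 17's coupling, and the located volume binder's FOUR dial inequalities at `V = 4((m₃+1)L)⁴`, `a₅ = ½`.  THIS FILE inhabits all of
them AT ONCE (`junction_numerals_joint_witness_vol`), in p. 21's order of choice: the floor and the package first (`refPackageJoint 1 F η R_σ` of
`B13ChainJointNonvacuityPrefactors`, two passes), then `M := κw + 1`, then the THREE VOLUME DIALS `θ₀ ≤ θ₀max`, `γ₂ ≤ γ₂max`, `α₄` by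
`B13VolumeDialNumerals.exists_dials_vol`, then `R_σ := R_σ,min(θ₀)`, then the record `c := constsOddL L M α₄` of (b1) — whose `Lemma3Numerics` at
`ℓ = L∕2` and c-level binders are `constsOddL_numerics` ∕ `constsOddL_junction` —, `cp := {c with κ₁ := κ₁ + 1}`, and p. 17's `r_P := √(rate∕γ₂)`;
the M⁴-threshold `hM4` FOLLOWS from the third dial inequality (`m4Min_le_of_dial`: `M⁴min = 12·D·m′α₄J ≤ M⁴` whenever `16·V·D·m′α₄J·M⁻⁴ ≤ a₅` and
`3a₅ ≤ 4V`).

WHAT THIS FILE PROVES (0 `sorry`).  §1 `m4Min_le_of_dial`, `one_lt_κ₁_constsOddL`; §2 ★★ `junction_numerals_joint_witness_vol (L m₃ : ℕ) (hL : 8 ≤ L)` — ONE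
record `c = constsOddL L M α₄` (`M ≥ κw + 1`, `α₄ > 0`), ONE `cp`, ONE admissible `rf`, reals `R₁ θ₀ γ₂ r_P ρΔ BΔ ηΔ μΔ M₁` meeting SIMULTANEOUSLY the
seven groups (0)–(7) below, conjunct for conjunct in the SHAPES of `b13LeafOfRecord_bondTower_of_numerics` (with `θ.ℓ₆ + 1 ↦ L`; its `hN12 hL8 hg hRσR
hPa` are the assembly's: `R := ⌈R_σ⌉₊`, `g := ε₁∕r_P`).

HONEST SCOPE.  Consistency of typed inequality lists at explicit (astronomical) witness constants; nothing about the size of Bałaban's constants;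
nothing of Bałaban's asserted; the junction's OBJECT binders are the bond tower's (`CarriersB13BondTower`), not touched here; the ∃-assembly
(item (c)) is the next file.  Count-neutral; N10 NOT discharged; K1⁸ NOT claimed; one finite four-torus programme at fixed ε; nothing continuum ∕
ℝ⁴ ∕ OS ∕ mass-gap ∕ Clay.
-/

noncomputable section

namespace Literature.MathematicalPhysics.QuantumFieldTheory.Balaban1983to89.B13ChainJointNonvacuityPrefactorsVol

open Literature.MathematicalPhysics.QuantumFieldTheory.Balaban1983to89
open Literature.MathematicalPhysics.QuantumFieldTheory.Balaban1983to89.B12TreeDecay (kappa₀ K₀ K₀_pos kappa₀_nonneg)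
open Literature.MathematicalPhysics.QuantumFieldTheory.Balaban1983to89.B13Bound143 (invTau R12)
open Literature.MathematicalPhysics.QuantumFieldTheory.Balaban1983to89.B13Lemma3WindowNonvacuity (κw aw δw μw)
open Literature.MathematicalPhysics.QuantumFieldTheory.Balaban1983to89.B13Lemma3TorusNonvacuity (κ₁t ε₁t)
open Literature.MathematicalPhysics.QuantumFieldTheory.Balaban1983to89.B13Lemma3TorusSocket (Lemma3Numerics)
open Literature.MathematicalPhysics.QuantumFieldTheory.Balaban1983to89.B13NodeTorusFamilyNonvacuity (aw_pos)
open Literature.MathematicalPhysics.QuantumFieldTheory.Balaban1983to89.B13Bound226Numerals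
  (coefQ coefQ' dSum theta0Max gamma2Max m4Min theta0Max_pos gamma2Max_pos m4Min_nonneg coefQ_nonneg coefQ'_nonneg dSum_pos_and_le)
open Literature.MathematicalPhysics.QuantumFieldTheory.Balaban1983to89.B13ChainJointNonvacuity226 (κw_lower)
open Literature.MathematicalPhysics.QuantumFieldTheory.Balaban1983to89.B13ChainJointNonvacuityPrefactors
  (constsQ8A constsQ8A_spec refPackageJoint refPackageJoint_admissible positiveRates_refPackageJoint etaMax_refPackageJoint_eq
    etaMax_refPackageJoint_pos_le)
open Literature.MathematicalPhysics.QuantumFieldTheory.Balaban1983to89.B13ChainJointNonvacuityOddL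
  (shiftK shiftE scaleL constsOddL constsOddL_numerics constsOddL_junction shiftK_nonneg shiftE_nonneg one_le_κ₁t one_sub_seven_δw_pos)
open Literature.MathematicalPhysics.QuantumFieldTheory.Balaban1983to89.B13VolumeDialNumerals (exists_dials_vol)
open Literature.MathematicalPhysics.QuantumFieldTheory.Balaban1983to89.B13EntrywiseBlockNumerals (kbarFloor kbarFloor_nonneg)
open Literature.MathematicalPhysics.QuantumFieldTheory.Balaban1983to89.B13RungDialNumerals
  (radiusStar alphaMax rsigmaMin radiusStar_pos alphaMax_pos)
open Literature.MathematicalPhysics.QuantumFieldTheory.Balaban1983to89.NodeOLettersOfWalksAcross (WalkPackage)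
open Literature.MathematicalPhysics.QuantumFieldTheory.Balaban1983to89.NodeOLettersOfWalksPerturbative (RefPackage)
open Literature.MathematicalPhysics.QuantumFieldTheory.Balaban1983to89.NodeOLettersOfWalksAcross.WalkPackage
  (kapCStar_spec rhoE_pos mu_pos Kbar_nonneg BΓ_nonneg)
open Literature.MathematicalPhysics.QuantumFieldTheory.Balaban1983to89.NodeOLettersOfWalksPerturbative.RefPackage
  (admissible_toWalkPackage cV_nonneg cV₀_nonneg c0_nonneg)

/-! ## §1. Two arithmetic remarks -/

/-- ★ **THE M⁴-THRESHOLD FOLLOWS FROM THE THIRD VOLUME DIAL.**  `M⁴min(1,1,m′,…,α₄,κ₁) = 12·D·(m′α₄J) ≤ M⁴` whenever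
`8V·D·(2(m′α₄M⁻⁴J)) ≤ a₅`, `3a₅ ≤ 4V`, `M > 0`, `D ≥ 0`, `m′α₄J ≥ 0` (`J := (1 + 32∕(κ₁−1))⁴`).
[cite: Balaban1988RG2Cluster, (2.20) p.16, (2.24)-(2.26) p.17] -/
theorem m4Min_le_of_dial {m' : ℕ} {cE BΓ cV c0η mA α₄ κ₁ M a₅ V : ℝ}
    (hD : 0 ≤ dSum 1 1 cE BΓ cV c0η mA) (hP : 0 ≤ (m' : ℝ) * α₄ * (1 + 32 / (κ₁ - 1)) ^ 4) (hM : 0 < M) (hV : 3 * a₅ ≤ 4 * V) (ha₅ : 0 < a₅)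
    (hαM : 8 * V * dSum 1 1 cE BΓ cV c0η mA * (2 * ((m' : ℝ) * α₄ * (M ^ 4)⁻¹ * (1 + 32 / (κ₁ - 1)) ^ 4)) ≤ a₅) :
    m4Min 1 1 m' cE BΓ cV c0η mA α₄ κ₁ ≤ M ^ 4 := by
  unfold m4Min
  have hM4 : 0 < M ^ 4 := pow_pos hM 4
  have hVpos : 0 < V := by linarith
  -- clear the `M⁻⁴`
  have e : 8 * V * dSum 1 1 cE BΓ cV c0η mA * (2 * ((m' : ℝ) * α₄ * (M ^ 4)⁻¹ * (1 + 32 / (κ₁ - 1)) ^ 4))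
      = (16 * V * (dSum 1 1 cE BΓ cV c0η mA * ((m' : ℝ) * α₄ * (1 + 32 / (κ₁ - 1)) ^ 4))) * (M ^ 4)⁻¹ := by ring
  rw [e, mul_inv_le_iff₀ hM4] at hαM
  have hDP : 0 ≤ dSum 1 1 cE BΓ cV c0η mA * ((m' : ℝ) * α₄ * (1 + 32 / (κ₁ - 1)) ^ 4) := mul_nonneg hD hP
  have h48 : (4 * V) * (12 * dSum 1 1 cE BΓ cV c0η mA * ((m' : ℝ) * α₄ * (1 + 32 / (κ₁ - 1)) ^ 4)) ≤ (4 * V) * M ^ 4 := by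
    nlinarith
  exact le_of_mul_le_mul_left h48 (by linarith)

/-- `1 < κ₁t + Δ_K(L)` (`κ₁t = 1 + 36μw`, `μw = (1−7δw)·4·κw`, `κw ≥ 1280`, `Δ_K ≥ 0`). [cite: Balaban1988RG2Cluster, p.21 (closing paragraph), witness-data bookkeeping] -/
theorem one_lt_κ₁_constsOddL {L : ℕ} (hL : 8 ≤ L) : 1 < κ₁t + shiftK L := by
  have hκ₁t : κ₁t = 1 + 36 * ((1 - 7 * δw) * 4 * κw) := rfl
  have hκw := κw_lower.2
  have hδ := one_sub_seven_δw_pos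
  have hΔ := shiftK_nonneg hL
  have hμ : 0 < (1 - 7 * δw) * 4 * κw := by positivity
  rw [hκ₁t]; linarith

/-! ## §2. The joint witness, volume binder located, at every block size -/

/-- ★★ **JOINT NON-VACUITY OF THE REDUCED JUNCTION's NUMERICS, AT EVERY BLOCK SIZE `L ≥ 8` AND BOND FINENESS `m₃ + 1`.**  There are ONE record
`c = constsOddL L M α₄` (`M ≥ κw + 1`, `α₄ > 0`), ONE `cp`, ONE admissible reference package `rf` and reals `R₁ θ₀ γ₂ r_P ρΔ BΔ ηΔ μΔ M₁` such that,
in the shapes of `b13LeafOfRecord_bondTower_of_numerics` (`θ.ℓ₆ + 1 ↦ L`): (1) the constants' 14 thresholds; (2) `Lemma3Numerics {c with L := L}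
(m₃+1) (L∕2) (aw + 40·log(m₃+1) + 20Δ_E(L) + 8(L−8)) 1 1 ½ 1`, `R12 {c with L := L}`, the signs, (2.18)'s `hτ2`; (3) `c.κ₁ < cp.κ₁`; (4) the rung at
`rf` — admissible, `R₁ = R*`, positive rates, `η ≤ η_max`, `0 < θ₀ ≤ θ₀max`, `R_σ,min(θ₀) ≤ R_σ`, and the tower's margins `m₀ ≤ 4`, `1 ≤ n_B`,
`1 ≤ d_m`, `ε_L ≤ ε_P …`; (5) NODE A at `ν = m_F = 1`, `c₀ = r_C = 0`: `4 ≤ BΔ`, budget, floor `≤ K̄_P`; (6) `0 ≤ γ₂ ≤ γ₂max`, `M⁴min ≤ M⁴`,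
`0 < r_P`, `rate ≤ γ₂ r_P²`; (7) the located volume binder's four dial inequalities at `V = 4((m₃+1)L)⁴`, `a₅ = ½`.
[cite: Balaban1988RG2Cluster, Lemma 1 (1.36) p.9, p.13, p.15, (2.16)–(2.18) p.16, (2.22) p.16, (2.24)-(2.26) p.17, Lemma 3 p.20, p.21 (closing paragraph); Balaban1987RG1, p.253; Balaban1985BackgroundPropagators, Thm 3.10 p.416; Balaban1984PropagatorsII, Lemma 2.1 (2.61) p.234] -/
theorem junction_numerals_joint_witness_vol (L m₃ : ℕ) (hL : 8 ≤ L) :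
    ∃ (c cp : B13.Consts) (rf : RefPackage) (R₁ θ₀ γ₂ rP ρΔ BΔ ηΔ μΔ M₁ : ℝ),
      -- (0) the record is a member of (b1)'s family
      (∃ M a : ℝ, κw + 1 ≤ M ∧ 0 < a ∧ c = constsOddL L M a) ∧
      -- (1) the constants' signs and thresholds (Lemma 1 ∕ 2)
      (0 ≤ c.κ ∧ c.δ < 1 ∧ 1 ≤ c.δ * c.κ ∧ kappa₀ 64 8 ≤ c.κ ∧ kappa₀ 64 8 ≤ c.δ * c.κ ∧
        1 + 2 * Real.log (8 * 12 ^ 3) ≤ c.κ₁ ∧ 2 + 16 * Real.log 128 ≤ c.κ₁ ∧ 0 ≤ c.δ₀ ∧ 0 ≤ c.M ∧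
        10 * Real.exp (-1) ≤ c.δ₀ * c.M ∧ 2 * Real.log 5 ≤ c.δ₀ * c.M ∧
        (1 - c.δ) * c.κ ≤ (1 / 4) * (c.κ₁ - 1) ∧ (1 - 2 * c.δ) * c.κ ≤ (1 / 16) * c.κ₁ ∧ 0 ≤ c.C₃) ∧
      -- (2) Lemma 3's numerics at block size `L`, bond fineness `m₃ + 1`; R12; signs; (2.18)
      (Lemma3Numerics ({ c with L := L } : B13.Consts) (m₃ + 1) (((L : ℕ) : ℝ) / 2)
          (aw + 40 * Real.log ((m₃ + 1 : ℕ) : ℝ) + 20 * shiftE L + 8 * ((L : ℝ) - 8)) 1 1 (1 / 2) 1 ∧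
        R12 ({ c with L := L } : B13.Consts) ∧ 0 < c.E₀ ∧ 0 < c.ε₁ ∧ 0 < c.C₁ ∧ 0 < c.α₄ ∧ 1 ≤ c.M ∧
        c.E₀ * c.ε₁ * c.C₁ * c.α₄⁻¹ * c.M ^ c.q * Real.exp (c.C₂ * c.κ₁) ≤ 1 / 2) ∧
      -- (3) one `cp`
      c.κ₁ < cp.κ₁ ∧
      -- (4) the rung at ONE admissible reference package, radius located, and the tower's margins
      (rf.Admissible ∧ R₁ = radiusStar rf.R rf.m₀ rf.mA₀ rf.KbarP rf.KbarA rf.cV rf.cV₀ ∧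
        (rf.toWalkPackage R₁).PositiveRates ∧ rf.η ≤ (rf.toWalkPackage R₁).etaMax ∧ 0 < θ₀ ∧
        θ₀ ≤ theta0Max 1 1 (rf.toWalkPackage R₁).kapCStar (rf.toWalkPackage R₁).Kbar (8 / rf.mA₀) (2 / rf.mA₀)
          (rf.toWalkPackage R₁).BΓ rf.cV (B6.c0 1 rf.η) rf.mA₀ ∧
        rsigmaMin θ₀ (rf.toWalkPackage R₁).Kbar (rf.toWalkPackage R₁).mu (rf.toWalkPackage R₁).kapCStar rf.m₀ rf.mA₀ rf.KbarP rf.KbarA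
          rf.cV rf.cV₀ rf.εP rf.εA ≤ rf.Rσ ∧
        rf.m₀ ≤ 4 ∧ 1 ≤ rf.nB ∧ 1 ≤ rf.dm ∧
        rf.εL ≤ rf.εP ∧ rf.kapL ≤ rf.kapP ∧ rf.KbarP ≤ rf.KbarL ∧ rf.εA ≤ rf.εP ∧ rf.kapA ≤ rf.kapP ∧ rf.KbarP ≤ rf.KbarA ∧
        rf.mA₀ ≤ rf.m₀) ∧
      -- (5) NODE A (`ν = m_F = 1`, `c₀ = r_C = 0`)
      (4 ≤ BΔ ∧ 0 < ηΔ ∧ 2 * cp.κ₁ ≤ ηΔ * M₁ ∧ 0 < μΔ ∧ ηΔ + rf.εP + rf.kapP + 4 * μΔ ≤ ρΔ ∧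
        kbarFloor 1 1 0 ρΔ ηΔ μΔ 0 cp.κ₁ BΔ ≤ rf.KbarP) ∧
      -- (6) the (2.24)–(2.26) located numerals at `m = ν = 1`, `m′ = 4(m₃+1)⁴`, and p. 17's coupling at the rate of (2)
      (0 ≤ γ₂ ∧ γ₂ ≤ gamma2Max 1 1 (2 / rf.mA₀) (rf.toWalkPackage R₁).BΓ rf.cV (B6.c0 1 rf.η) rf.mA₀ ∧
        m4Min 1 1 (4 * (m₃ + 1) ^ 4) (2 / rf.mA₀) (rf.toWalkPackage R₁).BΓ rf.cV (B6.c0 1 rf.η) rf.mA₀ c.α₄ c.κ₁ ≤ c.M ^ 4 ∧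
        0 < rP ∧ aw + 40 * Real.log ((m₃ + 1 : ℕ) : ℝ) + 20 * shiftE L + 8 * ((L : ℝ) - 8) ≤ γ₂ * rP ^ 2) ∧
      -- (7) the located volume binder: four dial inequalities at `V = 4((m₃+1)L)⁴`, `a₅ = ½`
      (4 * (4 * ((((m₃ + 1 : ℕ) : ℝ) * ((L : ℕ) : ℝ)) ^ 4)) *
            (3 * coefQ 1 1 (rf.toWalkPackage R₁).kapCStar (rf.toWalkPackage R₁).Kbar (8 / rf.mA₀) +
              2 * (dSum 1 1 (2 / rf.mA₀) (rf.toWalkPackage R₁).BΓ rf.cV (B6.c0 1 rf.η) rf.mA₀ *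
                coefQ' 1 1 (rf.toWalkPackage R₁).kapCStar (rf.toWalkPackage R₁).Kbar (8 / rf.mA₀))) * θ₀ ≤ 1 / 2 ∧
        8 * (4 * ((((m₃ + 1 : ℕ) : ℝ) * ((L : ℕ) : ℝ)) ^ 4)) * dSum 1 1 (2 / rf.mA₀) (rf.toWalkPackage R₁).BΓ rf.cV (B6.c0 1 rf.η) rf.mA₀ *
            γ₂ ≤ 1 / 2 ∧
        8 * (4 * ((((m₃ + 1 : ℕ) : ℝ) * ((L : ℕ) : ℝ)) ^ 4)) * dSum 1 1 (2 / rf.mA₀) (rf.toWalkPackage R₁).BΓ rf.cV (B6.c0 1 rf.η) rf.mA₀ *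
            (2 * ((((4 * (m₃ + 1) ^ 4 : ℕ)) : ℝ) * c.α₄ * (c.M ^ 4)⁻¹ * (1 + 32 / (c.κ₁ - 1)) ^ 4)) ≤ 1 / 2 ∧
        8 * (4 * ((((m₃ + 1 : ℕ) : ℝ) * ((L : ℕ) : ℝ)) ^ 4)) * (K₀ 64 8 * c.α₄) ≤ 1 / 2) := by
  -- ORDER OF CHOICE (p. 21).  (i) the record's `κ₁` (L-dependent, M-free), `cp.κ₁ := κ₁ + 1`, NODE A's rates, the floor `F` at `BΔ := 4`
  have hκw := κw_lower
  have hκ₁gt : 1 < κ₁t + shiftK L := one_lt_κ₁_constsOddL hL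
  let κp : ℝ := κ₁t + shiftK L + 1
  let ηΔ : ℝ := 2 * κp
  let ρΔ : ℝ := ηΔ + 1 + 1 + 4 * 1
  let F : ℝ := kbarFloor 1 1 0 ρΔ ηΔ 1 0 κp 4
  have hF : 0 ≤ F := kbarFloor_nonneg (by norm_num)
  -- (ii) the package, pass 1: `η := η_max` (η-free), radius `R₁ := R*`, the derived W-walks letters
  let η₀ : ℝ := ((refPackageJoint 1 F 1 0).toWalkPackage 1).etaMax
  obtain ⟨hη₀, hη₀1⟩ : 0 < η₀ ∧ η₀ ≤ 1 := etaMax_refPackageJoint_pos_le hF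
  let r₁ : RefPackage := refPackageJoint 1 F η₀ 0
  let R₁ : ℝ := radiusStar r₁.R r₁.m₀ r₁.mA₀ r₁.KbarP r₁.KbarA r₁.cV r₁.cV₀
  let q₁ : WalkPackage := r₁.toWalkPackage R₁
  have hr₁ : r₁.Admissible := refPackageJoint_admissible hF hη₀ hη₀1
  have hR₁ : 0 < R₁ := radiusStar_pos hr₁.hR hr₁.hm₀ hr₁.hmA₀ hr₁.hKbarP hr₁.hKbarA (cV_nonneg hr₁) (cV₀_nonneg hr₁)
  have hq₁ : q₁.Admissible := admissible_toWalkPackage hr₁ hR₁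
  have hp₁ : q₁.PositiveRates := positiveRates_refPackageJoint R₁
  have hκC : 0 < q₁.kapCStar := (kapCStar_spec hq₁ (rhoE_pos hp₁) (mu_pos hq₁ hp₁)).1
  have hKbar : 0 ≤ q₁.Kbar := Kbar_nonneg hq₁
  have hmA : (0 : ℝ) < r₁.mA₀ := hr₁.hmA₀
  have hcE : (0 : ℝ) ≤ 2 / r₁.mA₀ := div_nonneg (by norm_num) hmA.le
  have hKCs : (0 : ℝ) ≤ 8 / r₁.mA₀ := div_nonneg (by norm_num) hmA.le
  have hcV : 0 ≤ r₁.cV := cV_nonneg hr₁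
  have hc0 : 0 ≤ B6.c0 1 r₁.η := c0_nonneg hr₁.hη
  have hD := (dSum_pos_and_le 1 1 (cE := 2 / r₁.mA₀) (BΓ := q₁.BΓ) (cV := r₁.cV) (c0η := B6.c0 1 r₁.η) hcE hcV hc0 hmA).1
  -- (iii) the record's `M := κw + 1`; the THREE VOLUME DIALS `θ₀ γ₂ α₄` (`exists_dials_vol`) at `V := 4((m₃+1)L)⁴`, `a₅ := ½`
  let M : ℝ := κw + 1
  have hM : κw + 1 ≤ M := le_rfl
  have hM0 : 0 < M := by show 0 < κw + 1; linarith [hκw.1]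
  let V : ℝ := 4 * ((((m₃ + 1 : ℕ) : ℝ) * ((L : ℕ) : ℝ)) ^ 4)
  have hV0 : 0 ≤ V := by positivity
  have hV : 3 * (1 / 2 : ℝ) ≤ 4 * V := by
    have h1 : (1 : ℝ) ≤ ((m₃ + 1 : ℕ) : ℝ) := by exact_mod_cast Nat.succ_le_succ (Nat.zero_le m₃)
    have h2 : (1 : ℝ) ≤ ((L : ℕ) : ℝ) := by exact_mod_cast (show 1 ≤ L by omega)
    have h3 : (1 : ℝ) ≤ (((m₃ + 1 : ℕ) : ℝ) * ((L : ℕ) : ℝ)) ^ 4 := one_le_pow₀ (by nlinarith)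
    show 3 * (1 / 2 : ℝ) ≤ 4 * (4 * ((((m₃ + 1 : ℕ) : ℝ) * ((L : ℕ) : ℝ)) ^ 4))
    linarith
  obtain ⟨θ₀, γ₂, a, hθ₀, hγ, ha, hθle, hγle, hdθ, hdγ, hdM, hdK⟩ :=
    exists_dials_vol 1 1 (4 * (m₃ + 1) ^ 4) (KG := q₁.Kbar) (BΓ := q₁.BΓ) hκC hKCs hcE hcV hc0 hmA hM0 hκ₁gt
      (K0 := K₀ 64 8) (a₅ := 1 / 2) (V := V) (K₀_pos 64 8).le (by norm_num) hV0
  -- (iv) the package, pass 2: `R_σ := R_σ,min(θ₀)` (no derived letter reads `R_σ`)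
  let Rσ : ℝ := rsigmaMin θ₀ q₁.Kbar q₁.mu q₁.kapCStar r₁.m₀ r₁.mA₀ r₁.KbarP r₁.KbarA r₁.cV r₁.cV₀ r₁.εP r₁.εA
  let rf : RefPackage := refPackageJoint 1 F η₀ Rσ
  have hrf : rf.Admissible := refPackageJoint_admissible hF hη₀ hη₀1
  -- (v) the record and `cp`; (b1)'s two packages at it
  have hJ := constsOddL_junction (L := L) (M := M) (a := a) hL hM ha
  have hN := constsOddL_numerics (L := L) (M := M) (a := a) hL hM ha (m₃ + 1) (Nat.succ_le_succ (Nat.zero_le m₃))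
  obtain ⟨hκ, hδ1, hδκ, hκ126, hκ126', hκ₁, hκ₁', hδ₀, hM0', hδ₀M, hδ₀M5, hR8, hR9, hC₃, hE, hε, hC₁, hα, hM1, hτ2, h12⟩ := hJ
  -- (vi) p. 17's coupling at the rate of (2)
  have haw : 0 < aw := aw_pos
  have hlog : 0 ≤ Real.log ((m₃ + 1 : ℕ) : ℝ) := Real.log_nonneg (by exact_mod_cast Nat.succ_le_succ (Nat.zero_le m₃))
  have h8 : (8 : ℝ) ≤ (L : ℝ) := by exact_mod_cast hL
  have hΔE := shiftE_nonneg hL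
  have hrate : 0 < aw + 40 * Real.log ((m₃ + 1 : ℕ) : ℝ) + 20 * shiftE L + 8 * ((L : ℝ) - 8) := by nlinarith
  have hs : 0 < Real.sqrt ((aw + 40 * Real.log ((m₃ + 1 : ℕ) : ℝ) + 20 * shiftE L + 8 * ((L : ℝ) - 8)) / γ₂) :=
    Real.sqrt_pos.2 (div_pos hrate hγ)
  have hPa : aw + 40 * Real.log ((m₃ + 1 : ℕ) : ℝ) + 20 * shiftE L + 8 * ((L : ℝ) - 8) ≤
      γ₂ * Real.sqrt ((aw + 40 * Real.log ((m₃ + 1 : ℕ) : ℝ) + 20 * shiftE L + 8 * ((L : ℝ) - 8)) / γ₂) ^ 2 := by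
    rw [Real.sq_sqrt (div_pos hrate hγ).le]
    exact le_of_eq (by field_simp)
  -- (vii) the M⁴-threshold from the third dial
  have hP : 0 ≤ (((4 * (m₃ + 1) ^ 4 : ℕ)) : ℝ) * a * (1 + 32 / (κ₁t + shiftK L - 1)) ^ 4 := by
    have hk : 0 < κ₁t + shiftK L - 1 := by linarith
    positivity
  have hM4 : m4Min 1 1 (4 * (m₃ + 1) ^ 4) (2 / r₁.mA₀) q₁.BΓ r₁.cV (B6.c0 1 r₁.η) r₁.mA₀ a (κ₁t + shiftK L) ≤ M ^ 4 :=
    m4Min_le_of_dial hD.le hP hM0 hV (by norm_num) hdM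
  refine ⟨constsOddL L M a, { constsOddL L M a with κ₁ := κ₁t + shiftK L + 1 }, rf, R₁, θ₀, γ₂,
    Real.sqrt ((aw + 40 * Real.log ((m₃ + 1 : ℕ) : ℝ) + 20 * shiftE L + 8 * ((L : ℝ) - 8)) / γ₂), ρΔ, 4, ηΔ, 1, 1,
    ⟨M, a, hM, ha, rfl⟩, ⟨hκ, hδ1, hδκ, hκ126, hκ126', hκ₁, hκ₁', hδ₀, hM0', hδ₀M, hδ₀M5, hR8, hR9, hC₃⟩,
    ⟨hN, h12, hE, hε, hC₁, hα, hM1, hτ2⟩, ?_, ?_, ?_, ⟨hγ.le, hγle, hM4, hs, hPa⟩, ⟨hdθ, hdγ, hdM, hdK⟩⟩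
  · -- (3) `hκp`
    show κ₁t + shiftK L < κ₁t + shiftK L + 1
    linarith
  · -- (4) the rung at `rf` (every derived letter of `rf` is the corresponding letter of `r₁`)
    refine ⟨hrf, rfl, positiveRates_refPackageJoint R₁, ?_, hθ₀, hθle, le_rfl, ?_, ?_, ?_, ?_, ?_, ?_, ?_, ?_, ?_, ?_⟩
    · show η₀ ≤ (rf.toWalkPackage R₁).etaMax
      rw [etaMax_refPackageJoint_eq]
    · show (2 : ℝ) ≤ 4; norm_num
    · show (1 : ℕ) ≤ 1; exact le_rfl
    · show (1 : ℕ) ≤ 1; exact le_rfl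
    · show (1 : ℝ) ≤ 1; exact le_rfl
    · show (1 : ℝ) ≤ 1; exact le_rfl
    · show F ≤ F; exact le_rfl
    · show (1 : ℝ) ≤ 1; exact le_rfl
    · show (1 : ℝ) ≤ 1; exact le_rfl
    · show F ≤ F; exact le_rfl
    · show (1 : ℝ) ≤ 2; norm_num
  · -- (5) NODE A's budget and floor
    refine ⟨le_rfl, ?_, ?_, one_pos, ?_, le_rfl⟩
    · show 0 < 2 * (κ₁t + shiftK L + 1)
      linarith
    · show 2 * (κ₁t + shiftK L + 1) ≤ 2 * (κ₁t + shiftK L + 1) * 1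
      linarith
    · show ηΔ + 1 + 1 + 4 * 1 ≤ ρΔ
      exact le_rfl

end Literature.MathematicalPhysics.QuantumFieldTheory.Balaban1983to89.B13ChainJointNonvacuityPrefactorsVol

end
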